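import Literature.AlgebraicGeometry.Resolution.KnafKuhlmann2009Prop23
import Literature.AlgebraicGeometry.Resolution.PerronTransforms
import Mathlib.LinearAlgebra.Matrix.Basis
import Mathlib.RingTheory.FinitePresentation
import Mathlib.RingTheory.Smooth.Basic
import Mathlib.Data.Matrix.Basic
import Mathlib.Algebra.BigOperators.Field
import HarnessLib

/-!
# Knaf–Kuhlmann 2005, §4: local uniformization of Abhyankar places on rational function fields

Topic: `Literature/AlgebraicGeometry/Resolution`. First leg of the decomposition of the named
fact `KnafKuhlmann2005_Thm11` (Knaf–Kuhlmann 2005, Thm. 1.1: Abhyankar places admit local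
uniformization with a smooth centre; `FiniteExtensionUniformization.lean`), on which the fact
`KnafKuhlmann2009` now rests (`KnafKuhlmann2009.of_parts'`, `KnafKuhlmann2009Prop23.lean`).
Knaf–Kuhlmann prove Thm. 1.1 in three steps: §4 (Thm. 4.1) uniformizes the RATIONAL function
field `K(T)`, `T = (x, y)` an "Abhyankar" transcendence basis, by a change of the `xᵢ` through
Laurent monomials governed by a lemma on ordered abelian groups (Lemma 4.2, Zariski–Perron);
§3 (Thm. 3.4, resting on the Generalized Stability Theorem 3.1) puts `F` inside the absolute
inertia field of `K(T)`; §5 (Lemma 5.1) ascends along the resulting local-étale extension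
(`AbhyankarEtaleAscent.lean`). This file does §4 for a `K`-trivial place (`R = K`), everything
PROVED:

* `knafKuhlmann2005_lemma42_matrix` — Knaf–Kuhlmann 2005, Lemma 4.2 in the matrix form used
  below, a COROLLARY of the tree's `exists_basis_lt_one_of_injective` (`PerronTransforms.lean`,
  where Lemma 4.2 as printed is the proved `exists_basis_pos_forall_repr_nonneg`, Perron's
  algorithm): for `ℤ`-independent `τᵢ ≠ 0` in a value group and finitely many exponent vectors
  `h` with `∏ τᵢ^{hᵢ} ≤ 1` there is `C ∈ GLₙ(ℤ)` with `∏ᵢ τᵢ^{C j i} < 1` for all `j` and every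
  `h` an `ℕ`-combination of the rows of `C`.
* `knafKuhlmann2005_thm41_field` — **Knaf–Kuhlmann 2005, Thm. 4.1 for `R = K`** in the AMBIENT
  rendering of this topic (`K ≤ F` subfields of a valued field `(Ω, V)`, as in
  `KnafKuhlmann2005_Thm11` and `IsSmoothlyUniformizableIn`): for `K ⊆ O_P`, `x₁,…,x_ρ` with
  `ℤ`-independent values, `y₁,…,y_τ ∈ O_P` with residues algebraically independent over `KP`, and
  a finite `Z ⊆ O_P ∩ K(x, y)`, there are Laurent monomials `x'ⱼ ∈ K(x, y)` in the `xᵢ` with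
  `K(x') = K(x)`, `v(x'ⱼ) < 1`, `ℤ`-independent values, `(x', y)` algebraically independent over
  `K`, and `Z ⊆ K[x', y]_q` (`q` the centre): every `ζ ∈ Z` is `a/b` with `a, b ∈ K[x', y]`,
  `v(b) = 1`. Proof as printed, pp. 10–11, with `R = K`, `d = δ = 0`: write `ζ = F(x,y)/G(x,y)`,
  divide by the dominant monomial `x^{e₁}` of `G` (Knaf–Kuhlmann 2005, Thm. 2.1, PROVED in
  `ValuationIndependence.lean`) and apply Lemma 4.2 to the exponent differences.
* `isSmoothlyUniformizableIn_rational` — hence `(P|K(x,y), Z)` is smoothly `K`-uniformizable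
  (`IsSmoothlyUniformizableIn K V K(x,y) Z`, on `Spec K[x', y] ≅ 𝔸^{ρ+τ}`; KK05 p. 13: "In the case
  of `R = K`, the pair `(P|_{K(T)}, Z'')` is `K`-uniformizable on the affine space
  `X = 𝔸_K^{ρ+τ}` … due to Theorem 4.1").

## Relation to `ToricUniformization.lean`

The same mathematics (Temkin 2013, §5.1 and Lemma 5.3.2 = Knaf–Kuhlmann 2005, Thm. 4.1 for
`R = K`) is proved in `ToricUniformization.lean` (`exists_toricChart`,
`exists_regular_toricChart`) in the type-based rendering `[Algebra k K]`, `y : ι → K°`, with the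
REGULARITY of the local ring at the centre. The present ambient rendering is kept as a separate
theorem, rather than as a transport of `exists_regular_toricChart`, for one reason of content:
the étale ascent of `AbhyankarEtaleAscent.lean` needs the new variables INSIDE the rational
function field, `x'ⱼ ∈ K(x, y)` (the normal base `B = K[x', y][1/d]` must lie in `E = K(x, y)`
for the minimal polynomial of `η` over `E` to stay minimal over `B`), whereas the conclusion of
`exists_toricChart` records that the `xⱼ` are Laurent monomials in the `zᵢ` but not conversely,
with the number `N` of the `zᵢ` existential. (Should `exists_toricChart` export `zᵢ = x^{eᵢ}`,
this file reduces to a transport: `k := ↥K`, `O := V`, `KP ≅ K` for the `K`-trivial place.)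
The Laurent monomials with exponent FUNCTIONS `Fin ρ → ℤ` (rows of matrices) are written out as
`∏ i, x i ^ (m i)`; they are the `Finsupp` monomials there (`prod_zpow_eq_finsupp_prod`).

## Source

* H. Knaf, F.-V. Kuhlmann, *Abhyankar places admit local uniformization in any
  characteristic*, Ann. Sci. ÉNS 38 (2005) 833–846 = arXiv:math/0304159: §4, requirement (T)
  and Thm. 4.1 (p. 9), Lemma 4.2 (p. 9), proof of Thm. 4.1 (pp. 10–11), §5 p. 13. Pages refer
  to the arXiv PDF.
-/

noncomputable section

namespace Literature.AlgebraicGeometry.Resolution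

universe u

open IsLocalRing


/-- **Knaf–Kuhlmann 2005, Lemma 4.2, matrix form over a value group** — PROVED, a corollary of
`exists_basis_lt_one_of_injective` (`PerronTransforms.lean`: Perron's algorithm; the lemma as
printed is `exists_basis_pos_forall_repr_nonneg` there). For `ℤ`-independent non-zero elements
`τ₁,…,τₙ` of a linearly ordered commutative group with zero (so `Γ := ⊕ ℤτᵢ`, written
multiplicatively) and finitely many exponent vectors `h ∈ H ⊆ ℤⁿ` with `∏ τᵢ^{hᵢ} ≤ 1`
("non-negative elements" in additive notation), there is a new basis of `Γ`, given by the rows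
`Cⱼ` of a matrix `C ∈ GLₙ(ℤ)` (inverse `D`), consisting of elements `∏ᵢ τᵢ^{C j i} < 1`
("positive") such that every `h ∈ H` is an `ℕ`-combination of the rows.
[cite: KnafKuhlmann2005, Lemma 4.2] -/
theorem knafKuhlmann2005_lemma42_matrix (Γ₀ : Type*) [LinearOrderedCommGroupWithZero Γ₀] (n : ℕ)
    (τ : Fin n → Γ₀) (hτ0 : ∀ i, τ i ≠ 0)
    (hind : ∀ m : Fin n → ℤ, (∏ i, τ i ^ (m i)) = 1 → m = 0)
    (H : Finset (Fin n → ℤ)) (hH : ∀ h ∈ H, (∏ i, τ i ^ (h i)) ≤ 1) :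
    ∃ C D : Matrix (Fin n) (Fin n) ℤ, C * D = 1 ∧ D * C = 1 ∧
      (∀ j, (∏ i, τ i ^ (C j i)) < 1) ∧
      ∀ h ∈ H, ∃ e : Fin n → ℕ, ∀ i, h i = ∑ j, (e j : ℤ) * C j i := by
  classical
  -- the value homomorphism `φ : ℤⁿ → Γ₀ˣ`, `m ↦ ∏ τᵢ^{mᵢ}`
  let u : Fin n → Γ₀ˣ := fun i => Units.mk0 (τ i) (hτ0 i)
  let w : (Fin n → ℤ) → Γ₀ˣ := fun m => ∏ i, u i ^ (m i)
  have hw : ∀ m, ((w m : Γ₀ˣ) : Γ₀) = ∏ i, τ i ^ (m i) := fun m => by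
    simp only [w, u, Units.coe_prod, Units.val_zpow_eq_zpow_val, Units.val_mk0]
  have hw_add : ∀ m m', w (m + m') = w m * w m' := fun m m' => by
    simp only [w, Pi.add_apply, zpow_add, Finset.prod_mul_distrib]
  have hw_zero : w 0 = 1 := by simp [w]
  let φ : (Fin n → ℤ) →+ Additive Γ₀ˣ :=
    { toFun := fun m => Additive.ofMul (w m)
      map_zero' := by rw [hw_zero]; rfl
      map_add' := fun m m' => by rw [hw_add]; rfl }
  have hφw : ∀ m, Additive.toMul (φ m) = w m := fun m => rfl
  have hφ : Function.Injective φ := by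
    intro m m' h
    have h1 : w m = w m' := by rw [← hφw, ← hφw, h]
    have h2 : w (m - m') = 1 := by
      have h3 : w (m - m') * w m' = 1 * w m' := by rw [← hw_add, sub_add_cancel, one_mul, h1]
      exact mul_right_cancel h3
    have h3 : (∏ i, τ i ^ ((m - m') i)) = 1 := by rw [← hw, h2, Units.val_one]
    exact sub_eq_zero.mp (hind _ h3)
  have hD : ∀ h ∈ H, Additive.toMul (φ h) ≤ 1 := fun h hh => by
    rw [hφw, ← Units.val_le_val, hw, Units.val_one]
    exact hH h hh
  obtain ⟨e, he, -, hrepr⟩ := exists_basis_lt_one_of_injective φ hφ H hD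
  -- reindex the basis by `Fin n`
  have hrank : Module.finrank ℤ (Fin n → ℤ) = n := Module.finrank_fin_fun ℤ
  let σ : Fin (Module.finrank ℤ (Fin n → ℤ)) ≃ Fin n := finCongr hrank
  let e' : Module.Basis (Fin n) ℤ (Fin n → ℤ) := e.reindex σ
  have he' : ∀ j, e' j = e (σ.symm j) := fun j => Module.Basis.reindex_apply _ _ _
  -- the change-of-basis matrices
  let bf := Pi.basisFun ℤ (Fin n)
  let C : Matrix (Fin n) (Fin n) ℤ := (bf.toMatrix e').transpose
  let D : Matrix (Fin n) (Fin n) ℤ := (e'.toMatrix bf).transpose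
  have hC : ∀ j i, C j i = e' j i := fun j i => by
    simp only [C, Matrix.transpose_apply, Module.Basis.toMatrix_apply, bf, Pi.basisFun_repr]
  have hCD : C * D = 1 := by
    have h1 : e'.toMatrix bf * bf.toMatrix e' = 1 := Module.Basis.toMatrix_mul_toMatrix_flip _ _
    have h2 := congrArg Matrix.transpose h1
    rwa [Matrix.transpose_mul, Matrix.transpose_one] at h2
  have hDC : D * C = 1 := by
    have h1 : bf.toMatrix e' * e'.toMatrix bf = 1 := Module.Basis.toMatrix_mul_toMatrix_flip _ _
    have h2 := congrArg Matrix.transpose h1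
    rwa [Matrix.transpose_mul, Matrix.transpose_one] at h2
  refine ⟨C, D, hCD, hDC, fun j => ?_, fun h hh => ?_⟩
  · have h1 := he (σ.symm j)
    rw [hφw, ← Units.val_lt_val, hw, Units.val_one, ← he'] at h1
    simpa only [hC] using h1
  · obtain ⟨c, hc⟩ := hrepr h hh
    refine ⟨fun j => c (σ.symm j), fun i => ?_⟩
    have h1 : h = ∑ j, c (σ.symm j) • e' j := by
      rw [hc, ← Equiv.sum_comp σ.symm]
      simp only [he']
    conv_lhs => rw [h1]
    rw [Finset.sum_apply]
    refine Finset.sum_congr rfl fun j _ => ?_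
    rw [Pi.smul_apply, nsmul_eq_mul, hC]

variable {Ω : Type u} [Field Ω]

/-! ## Laurent monomials with exponent functions `Fin ρ → ℤ` -/

section Monomial

variable {ρ : ℕ} (x : Fin ρ → Ω)

/-! The Laurent monomials `x^m = ∏ xᵢ^{mᵢ}` below have exponent FUNCTIONS `m : Fin ρ → ℤ` — the
rows of the change-of-basis matrix of `knafKuhlmann2005_lemma42_matrix` are such functions —
and are written out as `∏ i, x i ^ (m i)`; they are the `Finsupp` Laurent monomials
`d.prod (fun j n => x j ^ n)` of `ToricUniformization.lean` (`prod_zpow_eq_finsupp_prod`), and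
the few identities below are the function-exponent forms of its `lmonomial_*` lemmas. -/

/-- `∏ xᵢ^{mᵢ}` is the `Finsupp` Laurent monomial of `ToricUniformization.lean` for the
finitely supported function defined by `m`. [folklore] -/
theorem prod_zpow_eq_finsupp_prod (m : Fin ρ → ℤ) :
    (∏ i, x i ^ (m i)) = (Finsupp.equivFunOnFinite.symm m).prod (fun j (n : ℤ) => x j ^ n) := by
  rw [Finsupp.prod_fintype _ _ (fun i => zpow_zero (x i))]
  rfl

/-- `x^{m+m'} = x^m x^{m'}` (for non-zero `xᵢ`). [folklore] -/
theorem prod_zpow_add (hx0 : ∀ i, x i ≠ 0) (m m' : Fin ρ → ℤ) :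
    (∏ i, x i ^ ((m + m') i)) = (∏ i, x i ^ (m i)) * ∏ i, x i ^ (m' i) := by
  simp only [Pi.add_apply, ← Finset.prod_mul_distrib]
  exact Finset.prod_congr rfl fun i _ => zpow_add₀ (hx0 i) _ _

/-- Laurent monomials in non-zero elements are non-zero. [folklore] -/
theorem prod_zpow_ne_zero (hx0 : ∀ i, x i ≠ 0) (m : Fin ρ → ℤ) : (∏ i, x i ^ (m i)) ≠ 0 :=
  Finset.prod_ne_zero_iff.mpr fun i _ => zpow_ne_zero _ (hx0 i)

/-- `x^{∑ mⱼ} = ∏ x^{mⱼ}`. [folklore] -/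
theorem prod_zpow_sum (hx0 : ∀ i, x i ≠ 0) {ι : Type*} (s : Finset ι) (m : ι → Fin ρ → ℤ) :
    (∏ i, x i ^ ((∑ j ∈ s, m j) i)) = ∏ j ∈ s, ∏ i, x i ^ (m j i) := by
  classical
  induction s using Finset.induction_on with
  | empty => simp
  | insert a s ha ih => rw [Finset.sum_insert ha, Finset.prod_insert ha, prod_zpow_add x hx0, ih]

/-- Laurent monomials with exponents in `ℕ^ρ` are ordinary monomials. [folklore] -/
theorem prod_zpow_natCast (e : Fin ρ → ℕ) :
    (∏ i, x i ^ ((e i : ℤ))) = ∏ i, x i ^ (e i) := by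
  simp only [zpow_natCast]

/-- `x^{eᵢ} = xᵢ`. [folklore] -/
theorem prod_zpow_single (i : Fin ρ) : (∏ j, x j ^ ((Pi.single i 1 : Fin ρ → ℤ) j)) = x i := by
  classical
  rw [Finset.prod_eq_single i]
  · simp
  · intro j _ hj; simp [hj]
  · intro h; exact absurd (Finset.mem_univ i) h

/-- `v(x^m) = ∏ v(xᵢ)^{mᵢ}`. [folklore] -/
theorem valuation_prod_zpow (V : ValuationSubring Ω) (m : Fin ρ → ℤ) :
    V.valuation (∏ i, x i ^ (m i)) = ∏ i, V.valuation (x i) ^ (m i) := by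
  simp only [map_prod, map_zpow₀]

/-- Laurent monomials in elements of a subfield lie in it. [folklore] -/
theorem prod_zpow_mem {S : Subfield Ω} (hx : ∀ i, x i ∈ S) (m : Fin ρ → ℤ) :
    (∏ i, x i ^ (m i)) ∈ S :=
  prod_mem fun i _ => zpow_mem (hx i) _

/-- `x^{n m} = (x^m)^n`. [folklore] -/
theorem prod_zpow_zsmul (n : ℤ) (m : Fin ρ → ℤ) :
    (∏ i, x i ^ ((n • m) i)) = (∏ i, x i ^ (m i)) ^ n := by
  simp only [Pi.smul_apply, smul_eq_mul]
  rw [← Finset.prod_zpow]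
  exact Finset.prod_congr rfl fun i _ => by rw [mul_comm, zpow_mul]

end Monomial

/-! ## Knaf–Kuhlmann 2005, Thm. 4.1 for `R = K` -/

section Thm41

variable (V : ValuationSubring Ω) (K : Subfield Ω)

/-- **Representation of an element of `O_P ∩ K(x, y)`** (Knaf–Kuhlmann 2005, proof of Thm. 4.1,
(3)–(4) on p. 10, case `R = K`): a non-zero `ζ ∈ O_P ∩ K(x, y)` is `F(x, y)/G(x, y)` with
`v(G(x, y)) = v(x^{e₁})` for the dominant exponent `e₁` of `G`, and every exponent `e` occurring
in `F` or `G` has `v(xᵉ) ≤ v(x^{e₁})` (for `G` by dominance, for `F` because `v(ζ) ≥ 0`; the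
coefficients, in `K ⊆ O_P`, are units). [cite: KnafKuhlmann2005, proof of Thm. 4.1 (p. 10)] -/
theorem exists_rep_of_mem_valuationSubring (hKV : ∀ c ∈ K, c ∈ V) {ρ τ : ℕ} {x : Fin ρ → Ω}
    {y : Fin τ → Ω} (hx0 : ∀ i, x i ≠ 0)
    (hxi : ∀ m : Fin ρ → ℤ, (∃ b ∈ K, (∏ i, V.valuation (x i) ^ (m i)) = V.valuation b) → m = 0)
    (hy : ∀ j, y j ∈ V)
    (hri : AlgebraicIndependent (resField V K) (fun j => residue V ⟨y j, hy j⟩))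
    {ζ : Ω} (hζ : ζ ∈ Subfield.closure ((K : Set Ω) ∪ (Set.range x ∪ Set.range y)))
    (hζV : ζ ∈ V) (hζ0 : ζ ≠ 0) :
    ∃ (F G : MvPolynomial (Fin ρ) (MvPolynomial (Fin τ) K)) (e₁ : Fin ρ →₀ ℕ),
      ζ = MvPolynomial.eval₂ (MvPolynomial.aeval y).toRingHom x F /
            MvPolynomial.eval₂ (MvPolynomial.aeval y).toRingHom x G ∧
      V.valuation (MvPolynomial.eval₂ (MvPolynomial.aeval y).toRingHom x G) =
        ∏ i, V.valuation (x i) ^ (e₁ i) ∧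
      ∀ e ∈ G.support ∪ F.support,
        (∏ i, V.valuation (x i) ^ (e i)) ≤ ∏ i, V.valuation (x i) ^ (e₁ i) := by
  classical
  obtain ⟨F, G, hrep⟩ := exists_eval₂_div_eq K x y hζ
  set Fv := MvPolynomial.eval₂ (MvPolynomial.aeval y).toRingHom x F with hFv
  set Gv := MvPolynomial.eval₂ (MvPolynomial.aeval y).toRingHom x G with hGv
  have hG : G ≠ 0 := by
    rintro rfl
    apply hζ0
    rw [hrep, hGv, MvPolynomial.eval₂_zero, div_zero]
  have hF : F ≠ 0 := by
    rintro rfl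
    apply hζ0
    rw [hrep, hFv, MvPolynomial.eval₂_zero, zero_div]
  have hcoef : ∀ (P : MvPolynomial (Fin ρ) (MvPolynomial (Fin τ) K)) (e : Fin ρ →₀ ℕ)
      (d : Fin τ →₀ ℕ), d ∈ (P.coeff e).support →
      V.valuation ((((P.coeff e).coeff d : K) : Ω)) = 1 := fun P e d hd =>
    valuation_eq_one_of_subfield_subset V (F := K) hKV ((P.coeff e).coeff d).2
      (by exact_mod_cast MvPolynomial.mem_support_iff.mp hd)
  obtain ⟨e₁, -, d₁, hd₁, hdomG, h', -, ε', -, hvh', -, hvε', hdecG⟩ :=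
    exists_dominant_term V K x y hx0 hxi hy hri G hG
  obtain ⟨e₀, -, d₀, hd₀, hdomF, h, -, ε, -, hvh, -, hvε, hdecF⟩ :=
    exists_dominant_term V K x y hx0 hxi hy hri F hF
  have hvG : V.valuation Gv = ∏ i, V.valuation (x i) ^ (e₁ i) := by
    rw [hGv, hdecG]
    simp only [map_mul, map_prod, map_pow, hcoef G e₁ d₁ hd₁, hvh',
      V.valuation.map_one_add_of_lt hvε', one_mul, mul_one]
  have hvF : V.valuation Fv = ∏ i, V.valuation (x i) ^ (e₀ i) := by
    rw [hFv, hdecF]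
    simp only [map_mul, map_prod, map_pow, hcoef F e₀ d₀ hd₀, hvh,
      V.valuation.map_one_add_of_lt hvε, one_mul, mul_one]
  refine ⟨F, G, e₁, hrep, hvG, fun e he => ?_⟩
  rcases Finset.mem_union.mp he with he | he
  · obtain ⟨d, hd⟩ := MvPolynomial.support_nonempty.mpr (MvPolynomial.mem_support_iff.mp he)
    have h1 := hdomG e he d hd
    rwa [hcoef G e d hd, hcoef G e₁ d₁ hd₁, one_mul, one_mul] at h1
  · obtain ⟨d, hd⟩ := MvPolynomial.support_nonempty.mpr (MvPolynomial.mem_support_iff.mp he)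
    have h1 := hdomF e he d hd
    rw [hcoef F e d hd, hcoef F e₀ d₀ hd₀, one_mul, one_mul] at h1
    have h2 : (∏ i, V.valuation (x i) ^ (e₀ i)) ≤ ∏ i, V.valuation (x i) ^ (e₁ i) := by
      rw [← hvF, ← hvG]
      have hGv0 : Gv ≠ 0 := fun h0 => by
        apply hζ0
        rw [hrep, h0, div_zero]
      have hFG : Fv = ζ * Gv := by
        rw [hrep, div_mul_cancel₀ _ hGv0]
      rw [hFG, map_mul]
      exact mul_le_of_le_one_left' ((V.valuation_le_one_iff ζ).mpr hζV)
    exact h1.trans h2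

/-- **Knaf–Kuhlmann 2005, Thm. 4.1, case `R = K`** (from Lemma 4.2). Let `K ⊆ O_P` (the place
is trivial on `K`), `x₁,…,x_ρ ≠ 0` with values `ℤ`-independent, `y₁,…,y_τ ∈ O_P` with residues
algebraically independent over `KP`, `F = K(x, y)` (requirement (T) of §4, by Thm. 2.1), and
`Z ⊆ O_P ∩ F` finite. Then there are Laurent monomials `x'₁,…,x'_ρ` in the `xᵢ` (a new basis of
the value group: `K(x') = K(x)`, values `ℤ`-independent) with `v(x'ⱼ) > 0`, such that, for the
POLYNOMIAL ring `A := K[x', y]` (`x', y` algebraically independent over `K`), every `ζ ∈ Z` is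
`a/b` with `a, b ∈ A` and `b` a unit at the centre (`Z ⊆ A_q`). (The paper's further conclusions
— `A_q` regular of dimension `ρ`, `ζ` an `A_q`-monomial in `x'` — are not derived here.)
[cite: KnafKuhlmann2005, Thm. 4.1 (case `R = K`) and its proof, pp. 9–11] -/
theorem knafKuhlmann2005_thm41_field (hKV : ∀ c ∈ K, c ∈ V) {ρ τ : ℕ} (x : Fin ρ → Ω) (y : Fin τ → Ω) (hx0 : ∀ i, x i ≠ 0)
    (hxi : ∀ m : Fin ρ → ℤ, (∃ b ∈ K, (∏ i, V.valuation (x i) ^ (m i)) = V.valuation b) → m = 0)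
    (hy : ∀ j, y j ∈ V)
    (hri : AlgebraicIndependent (resField V K) (fun j => residue V ⟨y j, hy j⟩))
    (Z : Finset Ω)
    (hZ : ∀ z ∈ Z, z ∈ V ∧ z ∈ Subfield.closure ((K : Set Ω) ∪ (Set.range x ∪ Set.range y))) :
    ∃ x' : Fin ρ → Ω,
      (∀ j, x' j ∈ Subfield.closure ((K : Set Ω) ∪ (Set.range x ∪ Set.range y)) ∧
        x' j ≠ 0 ∧ V.valuation (x' j) < 1) ∧
      (∀ i, x i ∈ Subfield.closure ((K : Set Ω) ∪ Set.range x')) ∧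
      (∀ m : Fin ρ → ℤ,
        (∃ b ∈ K, (∏ j, V.valuation (x' j) ^ (m j)) = V.valuation b) → m = 0) ∧
      AlgebraicIndependent K (Sum.elim x' y) ∧
      ∀ z ∈ Z, ∃ a ∈ Algebra.adjoin K (Set.range x' ∪ Set.range y),
        ∃ b ∈ Algebra.adjoin K (Set.range x' ∪ Set.range y), V.valuation b = 1 ∧ z = a / b := by
  classical
  set F₀ := Subfield.closure ((K : Set Ω) ∪ (Set.range x ∪ Set.range y)) with hF₀
  have hvx0 : ∀ i, V.valuation (x i) ≠ 0 := fun i => (map_ne_zero V.valuation).mpr (hx0 i)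
  -- representation data for the non-zero elements of `Z`
  have hrep : ∀ ζ : Z, ∃ (F G : MvPolynomial (Fin ρ) (MvPolynomial (Fin τ) K))
      (e₁ : Fin ρ →₀ ℕ), (ζ : Ω) ≠ 0 →
        ((ζ : Ω) = MvPolynomial.eval₂ (MvPolynomial.aeval y).toRingHom x F /
            MvPolynomial.eval₂ (MvPolynomial.aeval y).toRingHom x G ∧
        V.valuation (MvPolynomial.eval₂ (MvPolynomial.aeval y).toRingHom x G) =
          ∏ i, V.valuation (x i) ^ (e₁ i) ∧
        ∀ e ∈ G.support ∪ F.support,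
          (∏ i, V.valuation (x i) ^ (e i)) ≤ ∏ i, V.valuation (x i) ^ (e₁ i)) := by
    intro ζ
    by_cases h0 : (ζ : Ω) = 0
    · exact ⟨0, 0, 0, fun h => (h h0).elim⟩
    · obtain ⟨F, G, e₁, h⟩ := exists_rep_of_mem_valuationSubring V K hKV hx0 hxi hy hri
        (hZ ζ ζ.2).2 (hZ ζ ζ.2).1 h0
      exact ⟨F, G, e₁, fun _ => h⟩
  choose Fp Gp e1 hspec using hrep
  -- the finite set `H` of exponent differences
  let dif : Z → (Fin ρ →₀ ℕ) → (Fin ρ → ℤ) := fun ζ e i => (e i : ℤ) - (e1 ζ i : ℤ)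
  let H : Finset (Fin ρ → ℤ) := (Finset.univ.filter fun ζ : Z => (ζ : Ω) ≠ 0).biUnion
    fun ζ => ((Gp ζ).support ∪ (Fp ζ).support).image (dif ζ)
  have hdifH : ∀ ζ : Z, (ζ : Ω) ≠ 0 → ∀ e ∈ (Gp ζ).support ∪ (Fp ζ).support, dif ζ e ∈ H := by
    intro ζ hζ e he
    exact Finset.mem_biUnion.mpr ⟨ζ, Finset.mem_filter.mpr ⟨Finset.mem_univ _, hζ⟩,
      Finset.mem_image.mpr ⟨e, he, rfl⟩⟩
  have hvdif : ∀ (ζ : Z) (e : Fin ρ →₀ ℕ), (∏ i, V.valuation (x i) ^ (dif ζ e i)) =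
      (∏ i, V.valuation (x i) ^ (e i)) / ∏ i, V.valuation (x i) ^ (e1 ζ i) := by
    intro ζ e
    rw [← Finset.prod_div_distrib]
    refine Finset.prod_congr rfl fun i _ => ?_
    simp only [dif]
    rw [zpow_sub₀ (hvx0 i), zpow_natCast, zpow_natCast]
  have hH : ∀ h ∈ H, (∏ i, V.valuation (x i) ^ (h i)) ≤ 1 := by
    intro h hh
    obtain ⟨ζ, hζ, hh⟩ := Finset.mem_biUnion.mp hh
    have hζ0 : (ζ : Ω) ≠ 0 := (Finset.mem_filter.mp hζ).2
    obtain ⟨e, he, rfl⟩ := Finset.mem_image.mp hh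
    obtain ⟨-, -, hdom⟩ := hspec ζ hζ0
    rw [hvdif]
    exact div_le_one_of_le₀ (hdom e he) zero_le
  -- Lemma 4.2
  have hτind : ∀ m : Fin ρ → ℤ, (∏ i, V.valuation (x i) ^ (m i)) = 1 → m = 0 :=
    fun m hm => hxi m ⟨1, K.one_mem, by rw [hm, map_one]⟩
  obtain ⟨C, D, hCD, hDC, hpos, hexp⟩ :=
    knafKuhlmann2005_lemma42_matrix V.ValueGroup ρ (fun i => V.valuation (x i)) hvx0 hτind H hH
  -- the new variables `x'ⱼ := x^{Cⱼ}`
  let x' : Fin ρ → Ω := fun j => ∏ i, x i ^ (C j i)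
  have hvx' : ∀ j, V.valuation (x' j) = ∏ i, V.valuation (x i) ^ (C j i) := fun j =>
    valuation_prod_zpow x V (C j)
  have hx'lt : ∀ j, V.valuation (x' j) < 1 := fun j => by rw [hvx']; exact hpos j
  have hx'0 : ∀ j, x' j ≠ 0 := fun j => prod_zpow_ne_zero x hx0 _
  have hxF₀ : ∀ i, x i ∈ F₀ := fun i => Subfield.subset_closure (Or.inr (Or.inl ⟨i, rfl⟩))
  have hx'F : ∀ j, x' j ∈ F₀ := fun j => prod_zpow_mem x hxF₀ (C j)
  -- `x` in terms of `x'`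
  have hxx' : ∀ i, x i = ∏ j, x' j ^ (D i j) := by
    intro i
    have h1 : (∏ j, x' j ^ (D i j)) = ∏ i', x i' ^ ((∑ j, D i j • C j) i') := by
      rw [prod_zpow_sum x hx0]
      exact Finset.prod_congr rfl fun j _ => (prod_zpow_zsmul x (D i j) (C j)).symm
    have h2 : (∑ j, D i j • C j) = Pi.single i 1 := by
      funext k
      rw [Finset.sum_apply]
      simp only [Pi.smul_apply, smul_eq_mul]
      have hik := congr_fun (congr_fun hDC i) k
      rw [Matrix.mul_apply] at hik
      rw [hik, Matrix.one_apply, Pi.single_apply]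
      by_cases h : i = k
      · subst h; simp
      · rw [if_neg h, if_neg (Ne.symm h)]
    rw [h1, h2, prod_zpow_single]
  have hxF' : ∀ i, x i ∈ Subfield.closure ((K : Set Ω) ∪ Set.range x') := fun i => by
    rw [hxx' i]
    exact prod_zpow_mem x' (fun j => Subfield.subset_closure (Or.inr ⟨j, rfl⟩)) (D i)
  -- value independence of `x'`
  have hx'i : ∀ m : Fin ρ → ℤ,
      (∃ b ∈ K, (∏ j, V.valuation (x' j) ^ (m j)) = V.valuation b) → m = 0 := by
    rintro m ⟨b, hb, hm⟩
    have key : (∏ j, V.valuation (x' j) ^ (m j)) =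
        ∏ i, V.valuation (x i) ^ ((∑ j, m j • C j) i) := by
      rw [← valuation_prod_zpow x V, prod_zpow_sum x hx0, map_prod]
      refine Finset.prod_congr rfl fun j _ => ?_
      rw [prod_zpow_zsmul, map_zpow₀]
    have h0 := hxi (∑ j, m j • C j) ⟨b, hb, by rw [← key]; exact hm⟩
    funext k
    have hk : m k = ∑ i, (∑ j, m j • C j) i * D i k := by
      have hmul : ∀ j, (∑ i, m j * C j i * D i k) = m j * (C * D) j k := fun j => by
        rw [Matrix.mul_apply, Finset.mul_sum]
        exact Finset.sum_congr rfl fun i _ => by ring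
      simp only [Finset.sum_apply, Pi.smul_apply, smul_eq_mul, Finset.sum_mul]
      rw [Finset.sum_comm]
      simp only [hmul, hCD, Matrix.one_apply, mul_ite, mul_one, mul_zero, Finset.sum_ite_eq',
        Finset.mem_univ, if_true]
    rw [hk, h0]
    simp
  have hind : AlgebraicIndependent K (Sum.elim x' y) :=
    algebraicIndependent_sumElim_of_valIndep V K x' y hx'0 hx'i hy hri
  -- monomials with exponent in `H` are monomials in `x'`
  set A := Algebra.adjoin K (Set.range x' ∪ Set.range y) with hA
  have hmonoA : ∀ h ∈ H, (∏ i, x i ^ (h i)) ∈ A := by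
    intro h hh
    obtain ⟨e, he⟩ := hexp h hh
    have hsum : h = ∑ j, (e j : ℤ) • C j := by
      funext i
      rw [he i]
      simp only [Finset.sum_apply, Pi.smul_apply, smul_eq_mul]
    rw [hsum, prod_zpow_sum x hx0]
    refine prod_mem fun j _ => ?_
    rw [prod_zpow_zsmul, zpow_natCast]
    have hj : x' j ∈ A := Algebra.subset_adjoin (Or.inl ⟨j, rfl⟩)
    exact pow_mem hj _
  have hcoefA : ∀ (P : MvPolynomial (Fin ρ) (MvPolynomial (Fin τ) K)) (e : Fin ρ →₀ ℕ),
      MvPolynomial.aeval y (P.coeff e) ∈ A := by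
    intro P e
    have hmem : MvPolynomial.aeval y (P.coeff e) ∈ Algebra.adjoin K (Set.range y) := by
      rw [Algebra.adjoin_range_eq_range_aeval]
      exact ⟨_, rfl⟩
    exact Algebra.adjoin_mono Set.subset_union_right hmem
  refine ⟨x', fun j => ⟨hx'F j, hx'0 j, hx'lt j⟩, hxF', hx'i, hind, fun z hz => ?_⟩
  by_cases hz0 : z = 0
  · exact ⟨0, A.zero_mem, 1, A.one_mem, by rw [map_one], by rw [hz0, zero_div]⟩
  obtain ⟨hrepz, hvG, -⟩ := hspec ⟨z, hz⟩ hz0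
  set ζ : Z := ⟨z, hz⟩ with hζ
  set M := (∏ i, x i ^ ((e1 ζ i : ℤ))) with hM
  have hM0 : M ≠ 0 := prod_zpow_ne_zero x hx0 fun i => (e1 ζ i : ℤ)
  have hmon_eq : ∀ e : Fin ρ →₀ ℕ, (∏ i, x i ^ (e i)) = (∏ i, x i ^ (dif ζ e i)) * M := by
    intro e
    rw [hM, ← prod_zpow_add x hx0, ← prod_zpow_natCast]
    congr 1
    funext i
    simp [dif]
  have hdiv : ∀ P : MvPolynomial (Fin ρ) (MvPolynomial (Fin τ) K),
      (∀ e ∈ P.support, (∏ i, x i ^ (dif ζ e i)) ∈ A) →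
      MvPolynomial.eval₂ (MvPolynomial.aeval y).toRingHom x P / M ∈ A := by
    intro P hP
    have heq : MvPolynomial.eval₂ (MvPolynomial.aeval y).toRingHom x P / M =
        ∑ e ∈ P.support, MvPolynomial.aeval y (P.coeff e) * ∏ i, x i ^ (dif ζ e i) := by
      rw [eval₂_aeval_eq K x y P, Finset.sum_div]
      refine Finset.sum_congr rfl fun e _ => ?_
      rw [hmon_eq e, ← mul_assoc, mul_div_assoc, div_self hM0, mul_one]
    rw [heq]
    exact sum_mem fun e he => mul_mem (hcoefA P e) (hP e he)
  have haA := hdiv (Fp ζ) fun e he => hmonoA _ (hdifH ζ hz0 e (Finset.mem_union_right _ he))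
  have hbA := hdiv (Gp ζ) fun e he => hmonoA _ (hdifH ζ hz0 e (Finset.mem_union_left _ he))
  refine ⟨_, haA, _, hbA, ?_, ?_⟩
  · rw [map_div₀, hvG, hM, valuation_prod_zpow]
    simp only [zpow_natCast]
    exact div_self (Finset.prod_ne_zero_iff.mpr fun i _ => pow_ne_zero _ (hvx0 i))
  · rw [div_div_div_cancel_right₀ hM0]
    exact hrepz

/-- **Knaf–Kuhlmann 2005, Thm. 1.1 for rational function fields** (from Lemma 4.2): under the
hypotheses of `knafKuhlmann2005_thm41_field`, the pair `(P|K(x,y), Z)` is smoothly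
`K`-uniformizable — on the affine space `Spec K[x', y]` ("In the case of `R = K`, the pair
`(P|_{K(T)}, Z'')` is `K`-uniformizable on the affine space `X = 𝔸_K^{ρ+τ}` … due to Theorem 4.1",
KK05 p. 13). [cite: KnafKuhlmann2005, Thm. 4.1 and §5 (p. 13)] -/
theorem isSmoothlyUniformizableIn_rational (hKV : ∀ c ∈ K, c ∈ V) {ρ τ : ℕ} (x : Fin ρ → Ω) (y : Fin τ → Ω) (hx0 : ∀ i, x i ≠ 0)
    (hxi : ∀ m : Fin ρ → ℤ, (∃ b ∈ K, (∏ i, V.valuation (x i) ^ (m i)) = V.valuation b) → m = 0)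
    (hy : ∀ j, y j ∈ V)
    (hri : AlgebraicIndependent (resField V K) (fun j => residue V ⟨y j, hy j⟩))
    (Z : Finset Ω)
    (hZ : ∀ z ∈ Z, z ∈ V ∧ z ∈ Subfield.closure ((K : Set Ω) ∪ (Set.range x ∪ Set.range y))) :
    IsSmoothlyUniformizableIn K V (Subfield.closure ((K : Set Ω) ∪ (Set.range x ∪ Set.range y)))
      Z := by
  classical
  obtain ⟨x', hx', hxx', -, hind, hZA⟩ :=
    knafKuhlmann2005_thm41_field V K hKV x y hx0 hxi hy hri Z hZ
  set F₀ := Subfield.closure ((K : Set Ω) ∪ (Set.range x ∪ Set.range y)) with hF₀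
  set A := Algebra.adjoin K (Set.range x' ∪ Set.range y) with hA
  -- `A ⊆ V ∩ F₀`
  let VK : Subalgebra K Ω :=
    { V.toSubring with algebraMap_mem' := fun c => hKV c c.2 }
  have hAV' : A ≤ VK := by
    refine Algebra.adjoin_le ?_
    rintro w (⟨j, rfl⟩ | ⟨j, rfl⟩)
    · exact (V.valuation_le_one_iff _).mp (hx' j).2.2.le
    · exact hy j
  have hAV : A.toSubring ≤ V.toSubring := fun w hw => hAV' hw
  let FK : Subalgebra K Ω :=
    { F₀.toSubring with algebraMap_mem' := fun c => Subfield.subset_closure (Or.inl c.2) }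
  have hAF' : A ≤ FK := by
    refine Algebra.adjoin_le ?_
    rintro w (⟨j, rfl⟩ | ⟨j, rfl⟩)
    · exact (hx' j).1
    · exact Subfield.subset_closure (Or.inr (Or.inr ⟨j, rfl⟩))
  have hAF : (A : Set Ω) ⊆ F₀ := fun w hw => hAF' hw
  -- `A ≅ K[X, Y]`: finitely presented and formally smooth
  have hrange : Set.range (Sum.elim x' y) = Set.range x' ∪ Set.range y := Set.Sum.elim_range _ _
  let e : MvPolynomial (Fin ρ ⊕ Fin τ) K ≃ₐ[K] A :=
    hind.aevalEquiv.trans (Subalgebra.equivOfEq _ _ (by rw [hA, ← hrange]))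
  haveI : Algebra.FinitePresentation K A := Algebra.FinitePresentation.equiv e
  haveI : Algebra.FormallySmooth K A := Algebra.FormallySmooth.of_equiv e
  refine ⟨A, hAV, hAF, inferInstance, fun w hw => ?_, isSmoothAt_of_formallySmooth _, hZA⟩
  -- `Frac A = F₀`
  have hwc : w ∈ Subfield.closure (A : Set Ω) := by
    refine (Subfield.closure_le.mpr ?_) hw
    rintro u (hu | ⟨i, rfl⟩ | ⟨j, rfl⟩)
    · exact Subfield.subset_closure (A.algebraMap_mem (⟨u, hu⟩ : K))
    · refine Subfield.closure_le.mpr ?_ (hxx' i)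
      rintro u (hu | ⟨j, rfl⟩)
      · exact Subfield.subset_closure (A.algebraMap_mem (⟨u, hu⟩ : K))
      · exact Subfield.subset_closure (Algebra.subset_adjoin (Or.inl ⟨j, rfl⟩))
    · exact Subfield.subset_closure (Algebra.subset_adjoin (Or.inr ⟨j, rfl⟩))
  obtain ⟨a, ha, b, hb, rfl⟩ := Subfield.mem_closure_iff.mp hwc
  have hcl : Subring.closure (A : Set Ω) = A.toSubring := Subring.closure_eq A.toSubring
  rw [hcl] at ha hb
  exact ⟨a, ha, b, hb, rfl⟩

end Thm41

end Literature.AlgebraicGeometry.Resolution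

end
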